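import Literature.NumberTheory.Automorphic.ArchRankinSelbergPairBridge
import Literature.NumberTheory.Automorphic.TorusIntegrandThinSupport
import HarnessLib

/-!
# The thin PAIR torus integrand: support on units at the thin places, and the product form of the
# thin test function on the unit box

Topic `NumberTheory/Automorphic`; namespace `Literature.NumberTheory.Automorphic`. Plumbing for the
realisation of an archimedean Rankin–Selberg datum inside a global pair integral (the proof of the pole
of `L^S(s, π × π̃)` at `s = 1`, Jacquet–Shalika (1981), §4; Cogdell (2004), §2.3, §4.1): with the thin
test function `Φ = Φ_∞ ⊗ 𝟙_{thin box}` (`ThinTestFunction`) and a Whittaker function `W` spread at the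
places `v ∈ T` (`TorusIntegrandThinSupport`),

* `setIntegral_torusPairIntegrandC_thin_eq_unitBox_univ` — the pair integrand
  `W W' Φ(e_n ·) |det|^s δ⁻¹` over `B({v ∉ T}) × K` equals its integral over `B(all finite v) × K`: off
  the smaller box it vanishes (`valued_eq_one_of_torusIntegrand_thin_ne_zero`);
* `finLastRow`, `thinIndicatorGL`, `ofReal_thinTestFun_lastRow_eq` — on any `g`,
  `Φ(e_n g) = 𝟙_{thin}(e_n g_f) · Φ_∞((e_n g)_∞)`, the finite factor being a function of `g_f` alone;
* `thinIndicatorGL_mul_of_mem_finitePrincipalCongruenceLevel` — that finite factor is right invariant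
  under the principal congruence subgroup `K_f(𝔫)` as soon as `|𝔫|_v ≤ q_v^{-m}` for `v ∈ T`
  (`e_n (g u) - e_n = (e_n g - e_n) u + e_n (u - 1)`, ultrametric inequality).

## References

* J. W. Cogdell, *Analytic theory of L-functions for GL_n* (2004), §2.3, §4.1 [CogdellAnalyticTheory2004].
* H. Jacquet, J. A. Shalika, *On Euler products … I*, Amer. J. Math. 103 (1981), §4 [JacquetShalikaAJM1981].
-/

noncomputable section

open MeasureTheory Measure NumberField NumberField.mixedEmbedding IsDedekindDomain Set Filter WithZero
open Literature.NumberTheory.GaloisRepresentations (ideleGroup unitIdeles mem_unitIdeles_iff)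
open scoped MatrixGroups ENNReal NNReal Classical ComplexConjugate

namespace Literature.NumberTheory.Automorphic

/-! ### The finite last row and the thin indicator on `GL_n(𝔸_K^∞)` -/

section ThinIndicator

open ValuativeRel

variable (n : ℕ) (K : Type) [Field K] [NumberField K]

/-- The last standard basis row vector `e_n = (0, …, 0, 1)` of `(𝔸_K^∞)ⁿ`. [folklore] -/
def finLastBasisVec : Fin n → FiniteAdeleRing (𝓞 K) K := fun i => if (i : ℕ) + 1 = n then 1 else 0

/-- The finite last row `e_n g_f` of `g_f ∈ GL_n(𝔸_K^∞)`. [folklore] -/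
def finLastRow (g : GL (Fin n) (FiniteAdeleRing (𝓞 K) K)) : Fin n → FiniteAdeleRing (𝓞 K) K :=
  Matrix.vecMul (finLastBasisVec n K) (g : Matrix (Fin n) (Fin n) (FiniteAdeleRing (𝓞 K) K))

/-- The **thin indicator** `g_f ↦ 𝟙[e_n g_f ∈ thin box of (T, m)]` on `GL_n(𝔸_K^∞)` (complex valued).
[folklore] -/
def thinIndicatorGL (T : Finset (HeightOneSpectrum (𝓞 K))) (m : ℕ) (g : GL (Fin n) (FiniteAdeleRing (𝓞 K) K)) : ℂ :=
  if finLastRow n K g ∈ thinFiniteBox n K T m then 1 else 0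

variable {n K}

/-- The finite part of `e_n ∈ 𝔸_Kⁿ` is `e_n ∈ (𝔸_K^∞)ⁿ`. [folklore] -/
theorem snd_lastBasisVec (i : Fin n) : (lastBasisVec n K i).2 = finLastBasisVec n K i := by
  simp only [lastBasisVec, finLastBasisVec]
  split_ifs <;> rfl

/-- **`e_n g_f = (e_n g)_f`.** [folklore] -/
theorem finLastRow_sndHom (g : GL (Fin n) (AdeleRing (𝓞 K) K)) :
    finLastRow n K (GLn.sndHom n K g) = fun j => (lastRow n K g j).2 := by
  funext j
  simp only [finLastRow, lastRow, Matrix.vecMul, dotProduct]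
  rw [AdeleRing.snd_sum]
  refine Finset.sum_congr rfl fun i _ => ?_
  rw [← snd_lastBasisVec]
  rfl

/-- The thin indicator takes the values `0` and `1`; in particular it is real and non-negative. [folklore] -/
theorem thinIndicatorGL_eq_zero_or_one (T : Finset (HeightOneSpectrum (𝓞 K))) (m : ℕ)
    (g : GL (Fin n) (FiniteAdeleRing (𝓞 K) K)) :
    thinIndicatorGL n K T m g = 0 ∨ thinIndicatorGL n K T m g = 1 := by
  unfold thinIndicatorGL
  split_ifs
  · exact Or.inr rfl
  · exact Or.inl rfl

/-- `𝟙_{thin}(1) = 1`: `e_n` lies in the thin box. [folklore] -/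
theorem thinIndicatorGL_one (T : Finset (HeightOneSpectrum (𝓞 K))) (m : ℕ) :
    thinIndicatorGL n K T m 1 = 1 := by
  unfold thinIndicatorGL
  rw [if_pos]
  have h : finLastRow n K (1 : GL (Fin n) (FiniteAdeleRing (𝓞 K) K)) = finLastBasisVec n K := by
    simp only [finLastRow, Units.val_one, Matrix.vecMul_one]
  rw [h]
  exact lastBasisVec_mem_thinFiniteBox n K T m

/-- **`Φ(e_n g) = 𝟙_{thin}(e_n g_f) · Φ_∞((e_n g)_∞)` for the thin test function.** [folklore] -/
theorem ofReal_thinTestFun_lastRow_eq (Φinf : (Fin n → InfiniteAdeleRing K) → ℝ)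
    (T : Finset (HeightOneSpectrum (𝓞 K))) (m : ℕ) (g : GL (Fin n) (AdeleRing (𝓞 K) K)) :
    ((thinTestFun n K Φinf T m (lastRow n K g) : ℝ) : ℂ) =
      thinIndicatorGL n K T m (GLn.sndHom n K g) * ((Φinf (archLastRow n K (GLn.toMixed n K g)) : ℝ) : ℂ) := by
  unfold thinTestFun thinIndicatorGL
  rw [finLastRow_sndHom, archLastRow_toMixed]
  by_cases h : (fun j => (lastRow n K g j).2) ∈ thinFiniteBox n K T m
  · rw [if_pos h, if_pos h, one_mul]
  · rw [if_neg h, if_neg h, zero_mul, Complex.ofReal_zero]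

/-- Evaluation at `w` of a row-times-matrix product. [folklore] -/
theorem vecMul_apply_eval (z : Fin n → FiniteAdeleRing (𝓞 K) K)
    (u : Matrix (Fin n) (Fin n) (FiniteAdeleRing (𝓞 K) K)) (j : Fin n) (w : HeightOneSpectrum (𝓞 K)) :
    Matrix.vecMul z u j w = ∑ i, z i w * u i j w := by
  rw [Matrix.vecMul, dotProduct, ← AdelicGroupData.finiteAdeleEval_apply K w, _root_.map_sum]
  refine Finset.sum_congr rfl fun i _ => ?_
  rw [map_mul]
  rfl

/-- **The thin box is stable under `z ↦ z u` for `u` integral with `u ≡ 1 (mod 𝔭_v^m)`, `v ∈ T`.**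
`z u - e_n = (z - e_n) u + e_n (u - 1)`, and every term has valuation `≤ q_v^{-m}` at `v ∈ T`
(ultrametric inequality); integrality of `z u` is clear. [folklore] -/
theorem vecMul_mem_thinFiniteBox {T : Finset (HeightOneSpectrum (𝓞 K))} {m : ℕ}
    {z : Fin n → FiniteAdeleRing (𝓞 K) K} (hz : z ∈ thinFiniteBox n K T m)
    {u : Matrix (Fin n) (Fin n) (FiniteAdeleRing (𝓞 K) K)}
    (hu : ∀ i j, u i j ∈ integralFiniteAdeles K)
    (hu1 : ∀ v ∈ T, ∀ i j, Valued.v (u i j v - if i = j then 1 else 0) ≤ exp (-(m : ℤ))) :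
    Matrix.vecMul z u ∈ thinFiniteBox n K T m := by
  obtain ⟨hzint, hzc⟩ := hz
  have huint : ∀ i j w, Valued.v (u i j w) ≤ 1 := fun i j w =>
    (HeightOneSpectrum.mem_adicCompletionIntegers (R := 𝓞 K) K w).1 (hu i j w)
  have hzint' : ∀ i w, Valued.v (z i w) ≤ 1 := fun i w =>
    (HeightOneSpectrum.mem_adicCompletionIntegers (R := 𝓞 K) K w).1 (hzint i w)
  refine ⟨fun j w => ?_, fun v hv j => ?_⟩
  · rw [HeightOneSpectrum.mem_adicCompletionIntegers, vecMul_apply_eval]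
    refine Valued.v.map_sum_le fun i _ => ?_
    rw [map_mul]
    exact mul_le_one' (hzint' i w) (huint i j w)
  · -- `(z u)_j - δ_j = ∑_i (z_i - δ_i) u_ij + ∑_i δ_i (u_ij - δ_ij)`
    set δ : Fin n → v.adicCompletion K := fun i => if (i : ℕ) + 1 = n then 1 else 0 with hδ
    have hsplit : Matrix.vecMul z u j v - (if (j : ℕ) + 1 = n then 1 else 0) =
        ∑ i, (z i v - δ i) * u i j v + ∑ i, δ i * (u i j v - if i = j then 1 else 0) := by
      rw [vecMul_apply_eval]
      have h1 : ∑ i, (z i v - δ i) * u i j v = ∑ i, z i v * u i j v - ∑ i, δ i * u i j v := by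
        rw [← Finset.sum_sub_distrib]
        exact Finset.sum_congr rfl fun i _ => by ring
      have h2 : ∑ i, δ i * (u i j v - if i = j then 1 else 0) = ∑ i, δ i * u i j v - ∑ i, δ i * (if i = j then 1 else 0) := by
        rw [← Finset.sum_sub_distrib]
        exact Finset.sum_congr rfl fun i _ => by ring
      have h3 : ∑ i, δ i * (if i = j then (1 : v.adicCompletion K) else 0) = if (j : ℕ) + 1 = n then 1 else 0 := by
        rw [Finset.sum_eq_single j]
        · rw [if_pos rfl, mul_one]
        · intro i _ hi
          rw [if_neg hi, mul_zero]
        · intro h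
          exact absurd (Finset.mem_univ j) h
      rw [h1, h2, h3]
      ring
    rw [hsplit]
    refine Valued.v.map_add_le (Valued.v.map_sum_le fun i _ => ?_) (Valued.v.map_sum_le fun i _ => ?_)
    · rw [map_mul]
      calc Valued.v (z i v - δ i) * Valued.v (u i j v) ≤ exp (-(m : ℤ)) * 1 :=
            mul_le_mul' (hzc v hv i) (huint i j v)
        _ = exp (-(m : ℤ)) := mul_one _
    · rw [map_mul]
      have hδle : Valued.v (δ i) ≤ 1 := by
        simp only [hδ]
        split_ifs
        · rw [Valuation.map_one]
        · rw [Valuation.map_zero]; exact zero_le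
      calc Valued.v (δ i) * Valued.v (u i j v - if i = j then 1 else 0) ≤ 1 * exp (-(m : ℤ)) :=
            mul_le_mul' hδle (hu1 v hv i j)
        _ = exp (-(m : ℤ)) := one_mul _

/-- **Entrywise reading of `u ∈ K_f(𝔫)`**: the entries of `u` are integral and
`|u_{ab}(v) - δ_{ab}|_v ≤ |𝔫|_v` for every `v`. [folklore] -/
theorem entry_le_of_mem_finitePrincipalCongruenceLevel {𝔫 : Ideal (𝓞 K)}
    {u : GL (Fin n) (FiniteAdeleRing (𝓞 K) K)} (hu : u ∈ finitePrincipalCongruenceLevel n K 𝔫) :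
    (∀ a b, (u : Matrix (Fin n) (Fin n) (FiniteAdeleRing (𝓞 K) K)) a b ∈ integralFiniteAdeles K) ∧
      ∀ (v : HeightOneSpectrum (𝓞 K)) (a b : Fin n),
        Valued.v ((u : Matrix (Fin n) (Fin n) (FiniteAdeleRing (𝓞 K) K)) a b v - if a = b then 1 else 0) ≤
          idealRadius K v 𝔫 := by
  have hu' := (mem_finitePrincipalCongruenceLevel_iff).1 hu
  have hint : u ∈ glFiniteIntegralLevel n K := finitePrincipalCongruenceLevel_le n K 𝔫 hu
  refine ⟨(mem_glFiniteIntegralLevel_iff.1 hint).1, fun v a b => ?_⟩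
  obtain ⟨-, -, h3⟩ := ((mem_principalCongruenceLevel_iff).1 hu').2 v
  have h := h3 a b
  change Valued.v ((((Matrix.GeneralLinearGroup.map (AdelicGroupData.adeleEval K v) (GLn.ofFinite n K u) :
      GL (Fin n) (v.adicCompletion K)) : Matrix (Fin n) (Fin n) (v.adicCompletion K)) - 1) a b) ≤ _ at h
  rwa [Matrix.sub_apply, coe_map_adeleEval_ofFinite_apply, Matrix.one_apply] at h

/-- **The thin indicator is right `K_f(𝔫)`-invariant when `|𝔫|_v ≤ q_v^{-m}` for `v ∈ T`.** [folklore] -/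
theorem thinIndicatorGL_mul_of_mem_finitePrincipalCongruenceLevel {T : Finset (HeightOneSpectrum (𝓞 K))} {m : ℕ}
    {𝔫 : Ideal (𝓞 K)} (h𝔫 : ∀ v ∈ T, idealRadius K v 𝔫 ≤ exp (-(m : ℤ)))
    (g : GL (Fin n) (FiniteAdeleRing (𝓞 K) K)) {u : GL (Fin n) (FiniteAdeleRing (𝓞 K) K)}
    (hu : u ∈ finitePrincipalCongruenceLevel n K 𝔫) :
    thinIndicatorGL n K T m (g * u) = thinIndicatorGL n K T m g := by
  have hstab : ∀ {w : GL (Fin n) (FiniteAdeleRing (𝓞 K) K)} (_ : w ∈ finitePrincipalCongruenceLevel n K 𝔫)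
      {z : Fin n → FiniteAdeleRing (𝓞 K) K} (_ : z ∈ thinFiniteBox n K T m),
      Matrix.vecMul z (w : Matrix (Fin n) (Fin n) (FiniteAdeleRing (𝓞 K) K)) ∈ thinFiniteBox n K T m := by
    intro w hw z hz
    obtain ⟨hwint, hwc⟩ := entry_le_of_mem_finitePrincipalCongruenceLevel hw
    exact vecMul_mem_thinFiniteBox hz hwint fun v hv i j => (hwc v i j).trans (h𝔫 v hv)
  have hmul : finLastRow n K (g * u) = Matrix.vecMul (finLastRow n K g) (u : Matrix (Fin n) (Fin n) (FiniteAdeleRing (𝓞 K) K)) := by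
    simp only [finLastRow, Units.val_mul, Matrix.vecMul_vecMul]
  have hiff : finLastRow n K (g * u) ∈ thinFiniteBox n K T m ↔ finLastRow n K g ∈ thinFiniteBox n K T m := by
    rw [hmul]
    refine ⟨fun h => ?_, fun h => hstab hu h⟩
    have h' := hstab ((finitePrincipalCongruenceLevel n K 𝔫).inv_mem hu) h
    rwa [Matrix.vecMul_vecMul, ← Units.val_mul, mul_inv_cancel, Units.val_one, Matrix.vecMul_one] at h'
  unfold thinIndicatorGL
  rw [hiff]

end ThinIndicator

/-! ### The pair integrand over `B({v ∉ T}) × K` collapses to `B(all) × K` -/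

section PairSupport

open ValuativeRel

variable {n : ℕ} {K : Type} [Field K] [NumberField K]
variable [MeasurableSpace (ideleGroup K)] [BorelSpace (ideleGroup K)]
  [MeasurableSpace (AdelicGroupData.gl (n + 1) K).Adelic]

/-- **Reduction of the thin `T`-integral of a PAIR to the unit box at all finite places.** Under the
hypotheses of `valued_eq_one_of_torusIntegrand_thin_ne_zero` at EVERY `v ∈ T` for the first Whittaker
function `W` (the second, `W'`, is arbitrary),

  `∫_{B({v ∉ T}) × K} W W' Φ(e_n ·) |det|^s δ⁻¹ = ∫_{B(all finite v) × K} W W' Φ(e_n ·) |det|^s δ⁻¹`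

for the thin test function `Φ = thinTestFun Φ_∞ T m` and all measures: on `B({v ∉ T}) × K` the
integrand vanishes unless `a` is a unit at every `v ∈ T` too. [folklore] -/
theorem setIntegral_torusPairIntegrandC_thin_eq_unitBox_univ
    {ψ : AddChar (AdeleRing (𝓞 K) K) Circle} {W : GL (Fin (n + 1)) (AdeleRing (𝓞 K) K) → ℂ}
    (hWN : ∀ (u : ↥(adelicUnipotent (n + 1) K)) (g : GL (Fin (n + 1)) (AdeleRing (𝓞 K) K)),
      W ((u : GL (Fin (n + 1)) (AdeleRing (𝓞 K) K)) * g) = whittakerCharFun ψ u * W g)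
    (hWZ : ∀ (z : ideleGroup K) (g : GL (Fin (n + 1)) (AdeleRing (𝓞 K) K)),
      ‖W (Matrix.GeneralLinearGroup.scalar (Fin (n + 1)) z * g)‖ = ‖W g‖)
    {T : Finset (HeightOneSpectrum (𝓞 K))} {m : ℕ} (hm : 1 ≤ m)
    (hT : ∀ v ∈ T, ∃ (t : Fin (n + 1) → (v.adicCompletion K)ˣ) (M c₀ : ℤ),
      IsSpreadWhittakerAt v ψ t M W ∧
      (∃ x : v.adicCompletion K, Valued.v x ≤ exp (1 - c₀) ∧ ψ.adicComponent v x ≠ 1) ∧ 1 ≤ M ∧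
      (∀ i j : Fin (n + 1), i ≤ j → Valued.v (t j : v.adicCompletion K) ≤ Valued.v (t i : v.adicCompletion K)) ∧
      (∀ i j : Fin (n + 1), (i : ℕ) + 1 = j →
        exp (M - c₀) * Valued.v (t j : v.adicCompletion K) ≤ Valued.v (t i : v.adicCompletion K)) ∧
      exp (-(m : ℤ)) * Valued.v (t 0 : v.adicCompletion K) ≤
        exp (-M) * Valued.v (t (Fin.last n) : v.adicCompletion K))
    (W' : GL (Fin (n + 1)) (AdeleRing (𝓞 K) K) → ℂ) (Φinf : (Fin (n + 1) → InfiniteAdeleRing K) → ℝ) (s : ℂ)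
    (νA : Measure (Fin (n + 1) → ideleGroup K)) (νK : Measure ↥(maximalCompactAdelic (n + 1) K)) :
    ∫ p in unitBox {v | v ∉ (↑T : Set (HeightOneSpectrum (𝓞 K)))} ×ˢ Set.univ,
        torusPairIntegrandC (n + 1) K W W' (thinTestFun (n + 1) K Φinf T m) s p ∂(νA.prod νK) =
      ∫ p in unitBox (Set.univ : Set (HeightOneSpectrum (𝓞 K))) ×ˢ Set.univ,
        torusPairIntegrandC (n + 1) K W W' (thinTestFun (n + 1) K Φinf T m) s p ∂(νA.prod νK) := by
  classical
  set S₁ : Set ((Fin (n + 1) → ideleGroup K) × ↥(maximalCompactAdelic (n + 1) K)) :=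
    unitBox {v | v ∉ (↑T : Set (HeightOneSpectrum (𝓞 K)))} ×ˢ Set.univ with hS₁
  set S₂ : Set ((Fin (n + 1) → ideleGroup K) × ↥(maximalCompactAdelic (n + 1) K)) :=
    unitBox (Set.univ : Set (HeightOneSpectrum (𝓞 K))) ×ˢ Set.univ with hS₂
  have hsub : S₂ ⊆ S₁ := by
    rintro ⟨a, k⟩ ⟨ha, -⟩
    exact ⟨fun w _ i => ha w (Set.mem_univ w) i, Set.mem_univ _⟩
  have hS₁m : MeasurableSet S₁ := (measurableSet_unitBox _).prod MeasurableSet.univ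
  refine setIntegral_eq_of_subset_of_forall_sdiff_eq_zero hS₁m hsub ?_
  rintro ⟨a, k⟩ ⟨hp, hnot⟩
  -- off `S₂` one of the factors `W(diag(a) k)`, `Φ(e_n diag(a) k)` vanishes
  by_contra hne
  apply hnot
  have hW0 : W (torusPoint (n + 1) K (a, k)) ≠ 0 := by
    intro h
    apply hne
    simp only [torusPairIntegrandC, h, zero_mul]
  have hΦ0 : thinTestFun (n + 1) K Φinf T m (lastRow (n + 1) K (torusPoint (n + 1) K (a, k))) ≠ 0 := by
    intro h
    apply hne
    simp only [torusPairIntegrandC, h, Complex.ofReal_zero, mul_zero, zero_mul]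
  refine ⟨fun w _ i => ?_, Set.mem_univ _⟩
  by_cases hw : w ∈ T
  · obtain ⟨t, M, c₀, hWv, hψv, hM₁, hmono, hgap, hmt⟩ := hT w hw
    exact valued_eq_one_of_torusIntegrand_thin_ne_zero hWN hWZ hWv hψv hM₁ hmono hgap hm hmt hw a k hW0 hΦ0 i
  · exact hp.1 w hw i

end PairSupport

end Literature.NumberTheory.Automorphic
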